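import Mathlib
import Summits.ResolutionOfSingularities.ResolutionOfSingularities.Theorems.HomologicalConductorPersistenceArenaGeneral
import Summits.ResolutionOfSingularities.ResolutionOfSingularities.Theorems.HomologicalConductorPersistenceArenaGlue
import HarnessLib

/-!
# K-SD0 `StrictDrop` (stmt-ResolutionOfSingularities-16485) / rung S-2 `PersistenceSurface` (stmt-…-19970) — the cA-ARENA SANDWICH at the
# Hilbert level: `ι c ∈ caⁿ⁺³(k[x,y,z]/(xy − h)) ↔ c̄ ∈ caⁿ⁺¹(k[z]/(h))`, and the enabling formula along the concrete projection `ρ₀`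

Route `ResolutionOfSingularities/HomologicalConductor`, chain W4.4b (cell `res-hironaka`).  `[OURS · L1 w44b · res-L1-w44b-stub-2 gen 4]`; NOT a
statement of the manuscript under review (Hironaka 2017), no statement of that manuscript is used; AI-written, weaker than expert review.

`S = k[z₁,…,z_{n+1}]`, `T_h = k[x,y,z]/(xy − ι h)` (`…PersistenceArenaGeneral`), `C_h = S/(h)`, `ρ₀ : T_h → C_h` the projection `x, y ↦ 0`,
`zⱼ ↦ z̄ⱼ` (`Ideal.Quotient.lift` of `mk ∘ aeval (0, 0, z)`).  For `char k ≠ 2`, `h ≠ 0`: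

* **`mk_inclusion_mem_cohomologyAnnihilatorOfDegree_iff`**: `ι c ∈ caⁿ⁺³(T_h) ↔ c̄ ∈ caⁿ⁺¹(C_h)` — lower half `…ArenaGeneral.mk_inclusion_mem_…`
  (p544909, CA3 + Knörrer (i) retract), upper half `…ArenaGlue.map_cohomologyAnnihilatorOfDegree_le` (p550165 + glue: two branched-cover descents);
* **`cohomologyAnnihilator_eq_comap_proj`**: `ca(T_h) = ρ₀⁻¹(ca(C_h))`; **`mem_cohomologyAnnihilator_iff`**: `t ∈ ca(T_h) ↔ ρ₀ t ∈ ca(C_h)`.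
-/

noncomputable section

-- single-problem summit: the doubled namespace component `ResolutionOfSingularities` is forced
set_option linter.dupNamespace false

namespace Summit.ResolutionOfSingularities.ResolutionOfSingularities.Theorems.HomologicalConductor.ArenaSandwich

open Literature.RingTheory.CohomologyAnnihilator
open Summit.ResolutionOfSingularities.ResolutionOfSingularities.Theorems.HomologicalConductor
open scoped nonZeroDivisors

universe u

variable (k : Type u) [Field k] (n : ℕ)

/-! ## §1 The projection `ρ₀ : k[x,y,z]/(xy − ι h) → k[z]/(h)` -/

/-- `π ∘ ι = id` on `k[z]` for `π : x, y ↦ 0, zⱼ ↦ zⱼ`. [folklore] -/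
theorem aeval_proj_inclusion (s : MvPolynomial (Fin (n + 1)) k) :
    MvPolynomial.aeval (Fin.cons 0 (Fin.cons 0 fun j : Fin (n + 1) => (MvPolynomial.X j : MvPolynomial (Fin (n + 1)) k)) :
        Fin (n + 3) → MvPolynomial (Fin (n + 1)) k)
      ((MvPolynomial.aeval fun j : Fin (n + 1) => (MvPolynomial.X j.succ.succ : MvPolynomial (Fin (n + 3)) k)) s) = s := by
  rw [← AlgHom.comp_apply, MvPolynomial.comp_aeval]
  have hid : (MvPolynomial.aeval fun i : Fin (n + 1) =>
      (MvPolynomial.aeval (Fin.cons 0 (Fin.cons 0 fun j : Fin (n + 1) => (MvPolynomial.X j : MvPolynomial (Fin (n + 1)) k)) :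
          Fin (n + 3) → MvPolynomial (Fin (n + 1)) k)) (MvPolynomial.X i.succ.succ : MvPolynomial (Fin (n + 3)) k)) =
      AlgHom.id k (MvPolynomial (Fin (n + 1)) k) := by
    refine MvPolynomial.algHom_ext fun j => ?_
    rw [MvPolynomial.aeval_X, MvPolynomial.aeval_X, Fin.cons_succ, Fin.cons_succ, AlgHom.id_apply]
  rw [hid, AlgHom.id_apply]

/-- `π(xy − ι h) = −h`. [folklore] -/
theorem aeval_proj_f (h : MvPolynomial (Fin (n + 1)) k) :
    MvPolynomial.aeval (Fin.cons 0 (Fin.cons 0 fun j : Fin (n + 1) => (MvPolynomial.X j : MvPolynomial (Fin (n + 1)) k)) :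
        Fin (n + 3) → MvPolynomial (Fin (n + 1)) k)
      (MvPolynomial.X 0 * MvPolynomial.X 1 -
        (MvPolynomial.aeval fun j : Fin (n + 1) => (MvPolynomial.X j.succ.succ : MvPolynomial (Fin (n + 3)) k)) h) = -h := by
  rw [map_sub, map_mul, MvPolynomial.aeval_X, Fin.cons_zero, zero_mul, zero_sub, aeval_proj_inclusion]

/-- `mk ∘ π` kills the ideal `(xy − ι h)`. [folklore] -/
theorem mk_aeval_proj_eq_zero_of_mem (h : MvPolynomial (Fin (n + 1)) k) (a : MvPolynomial (Fin (n + 3)) k)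
    (ha : a ∈ Ideal.span {MvPolynomial.X 0 * MvPolynomial.X 1 -
      (MvPolynomial.aeval fun j : Fin (n + 1) => (MvPolynomial.X j.succ.succ : MvPolynomial (Fin (n + 3)) k)) h}) :
    ((Ideal.Quotient.mk (Ideal.span {h})).comp
      (MvPolynomial.aeval (Fin.cons 0 (Fin.cons 0 fun j : Fin (n + 1) => (MvPolynomial.X j : MvPolynomial (Fin (n + 1)) k)) :
          Fin (n + 3) → MvPolynomial (Fin (n + 1)) k) : MvPolynomial (Fin (n + 3)) k →ₐ[k] MvPolynomial (Fin (n + 1)) k).toRingHom) a = 0 := by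
  obtain ⟨b, rfl⟩ := Ideal.mem_span_singleton'.mp ha
  rw [RingHom.comp_apply, AlgHom.toRingHom_eq_coe, RingHom.coe_coe, map_mul, aeval_proj_f, mul_neg, map_neg, neg_eq_zero,
    Ideal.Quotient.eq_zero_iff_mem]
  exact Ideal.mul_mem_left _ _ (Ideal.mem_span_singleton_self h)

/-- `ρ₀(x̄) = 0`. [folklore] -/
theorem proj_mk_X_zero (h : MvPolynomial (Fin (n + 1)) k) :
    Ideal.Quotient.lift _ _ (mk_aeval_proj_eq_zero_of_mem k n h) (Ideal.Quotient.mk _ (MvPolynomial.X 0)) = 0 := by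
  rw [Ideal.Quotient.lift_mk, RingHom.comp_apply, AlgHom.toRingHom_eq_coe, RingHom.coe_coe, MvPolynomial.aeval_X, Fin.cons_zero,
    map_zero]

/-- `ρ₀(ȳ) = 0`. [folklore] -/
theorem proj_mk_X_one (h : MvPolynomial (Fin (n + 1)) k) :
    Ideal.Quotient.lift _ _ (mk_aeval_proj_eq_zero_of_mem k n h) (Ideal.Quotient.mk _ (MvPolynomial.X 1)) = 0 := by
  rw [Ideal.Quotient.lift_mk, RingHom.comp_apply, AlgHom.toRingHom_eq_coe, RingHom.coe_coe, MvPolynomial.aeval_X,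
    show (1 : Fin (n + 3)) = Fin.succ 0 from rfl, Fin.cons_succ, Fin.cons_zero, map_zero]

/-- `ρ₀(z̄ⱼ) = z̄ⱼ`. [folklore] -/
theorem proj_mk_X_succ_succ (h : MvPolynomial (Fin (n + 1)) k) (j : Fin (n + 1)) :
    Ideal.Quotient.lift _ _ (mk_aeval_proj_eq_zero_of_mem k n h) (Ideal.Quotient.mk _ (MvPolynomial.X j.succ.succ)) =
      Ideal.Quotient.mk (Ideal.span {h}) (MvPolynomial.X j) := by
  rw [Ideal.Quotient.lift_mk, RingHom.comp_apply, AlgHom.toRingHom_eq_coe, RingHom.coe_coe, MvPolynomial.aeval_X, Fin.cons_succ,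
    Fin.cons_succ]

/-- `ρ₀(c̄) = c̄` for constants. [folklore] -/
theorem proj_mk_C (h : MvPolynomial (Fin (n + 1)) k) (c : k) :
    Ideal.Quotient.lift _ _ (mk_aeval_proj_eq_zero_of_mem k n h) (Ideal.Quotient.mk _ (MvPolynomial.C c)) =
      Ideal.Quotient.mk (Ideal.span {h}) (MvPolynomial.C c) := by
  rw [Ideal.Quotient.lift_mk, RingHom.comp_apply, AlgHom.toRingHom_eq_coe, RingHom.coe_coe, MvPolynomial.algHom_C,
    MvPolynomial.algebraMap_eq]

/-- `ρ₀(ι s) = s̄` for `s ∈ k[z]`. [folklore] -/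
theorem proj_mk_inclusion (h : MvPolynomial (Fin (n + 1)) k) (s : MvPolynomial (Fin (n + 1)) k) :
    Ideal.Quotient.lift _ _ (mk_aeval_proj_eq_zero_of_mem k n h) (Ideal.Quotient.mk _
      ((MvPolynomial.aeval fun j : Fin (n + 1) => (MvPolynomial.X j.succ.succ : MvPolynomial (Fin (n + 3)) k)) s)) =
      Ideal.Quotient.mk (Ideal.span {h}) s := by
  rw [Ideal.Quotient.lift_mk, RingHom.comp_apply, AlgHom.toRingHom_eq_coe, RingHom.coe_coe, aeval_proj_inclusion]

/-! ## §2 The sandwich and the enabling formula along `ρ₀` -/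

/-- **cA-ARENA SANDWICH at the Hilbert level** (`char k ≠ 2`, `h ≠ 0`): for `c ∈ k[z₁,…,z_{n+1}]`,
`ι c ∈ caⁿ⁺³(k[x,y,z]/(xy − h)) ↔ c̄ ∈ caⁿ⁺¹(k[z]/(h))`. (←) `…ArenaGeneral.mk_inclusion_mem_cohomologyAnnihilatorOfDegree`;
(→) `…ArenaGlue.map_cohomologyAnnihilatorOfDegree_le` along `ρ₀`. [OURS · L1 w44b] -/
theorem mk_inclusion_mem_cohomologyAnnihilatorOfDegree_iff (h2 : (2 : k) ≠ 0) (h : MvPolynomial (Fin (n + 1)) k) (hh : h ≠ 0)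
    (c : MvPolynomial (Fin (n + 1)) k) :
    Ideal.Quotient.mk (Ideal.span {MvPolynomial.X 0 * MvPolynomial.X 1 -
        (MvPolynomial.aeval fun j : Fin (n + 1) => (MvPolynomial.X j.succ.succ : MvPolynomial (Fin (n + 3)) k)) h})
        ((MvPolynomial.aeval fun j : Fin (n + 1) => (MvPolynomial.X j.succ.succ : MvPolynomial (Fin (n + 3)) k)) c) ∈
      cohomologyAnnihilatorOfDegree (MvPolynomial (Fin (n + 3)) k ⧸ Ideal.span {MvPolynomial.X 0 * MvPolynomial.X 1 -
        (MvPolynomial.aeval fun j : Fin (n + 1) => (MvPolynomial.X j.succ.succ : MvPolynomial (Fin (n + 3)) k)) h}) (n + 3) ↔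
    Ideal.Quotient.mk (Ideal.span {h}) c ∈ cohomologyAnnihilatorOfDegree (MvPolynomial (Fin (n + 1)) k ⧸ Ideal.span {h}) (n + 1) := by
  constructor
  · intro hc
    have hle := ArenaGlue.map_cohomologyAnnihilatorOfDegree_le k n h2 h hh n _ (proj_mk_X_zero k n h) (proj_mk_X_one k n h)
      (proj_mk_X_succ_succ k n h) (proj_mk_C k n h)
    have hc' := (Ideal.map_le_iff_le_comap.mp hle) hc
    rw [Ideal.mem_comap, proj_mk_inclusion] at hc'
    exact hc'
  · exact ArenaGeneral.mk_inclusion_mem_cohomologyAnnihilatorOfDegree k n h2 h hh c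

/-- **ENABLING FORMULA along `ρ₀`**: `ca(k[x,y,z]/(xy − h)) = ρ₀⁻¹(ca(k[z]/(h)))` (`char k ≠ 2`, `h ≠ 0`). [OURS · L1 w44b] -/
theorem cohomologyAnnihilator_eq_comap_proj (h2 : (2 : k) ≠ 0) (h : MvPolynomial (Fin (n + 1)) k) (hh : h ≠ 0) :
    cohomologyAnnihilator (MvPolynomial (Fin (n + 3)) k ⧸ Ideal.span {MvPolynomial.X 0 * MvPolynomial.X 1 -
        (MvPolynomial.aeval fun j : Fin (n + 1) => (MvPolynomial.X j.succ.succ : MvPolynomial (Fin (n + 3)) k)) h}) =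
      (cohomologyAnnihilator (MvPolynomial (Fin (n + 1)) k ⧸ Ideal.span {h})).comap
        (Ideal.Quotient.lift _ _ (mk_aeval_proj_eq_zero_of_mem k n h)) :=
  ArenaGlue.cohomologyAnnihilator_eq_comap k n h2 h hh _ (proj_mk_X_zero k n h) (proj_mk_X_one k n h)
    (proj_mk_X_succ_succ k n h) (proj_mk_C k n h)

/-- Membership form: `t ∈ ca(k[x,y,z]/(xy − h)) ↔ ρ₀ t ∈ ca(k[z]/(h))`. [OURS · L1 w44b] -/
theorem mem_cohomologyAnnihilator_iff (h2 : (2 : k) ≠ 0) (h : MvPolynomial (Fin (n + 1)) k) (hh : h ≠ 0)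
    (t : MvPolynomial (Fin (n + 3)) k ⧸ Ideal.span {MvPolynomial.X 0 * MvPolynomial.X 1 -
        (MvPolynomial.aeval fun j : Fin (n + 1) => (MvPolynomial.X j.succ.succ : MvPolynomial (Fin (n + 3)) k)) h}) :
    t ∈ cohomologyAnnihilator (MvPolynomial (Fin (n + 3)) k ⧸ Ideal.span {MvPolynomial.X 0 * MvPolynomial.X 1 -
        (MvPolynomial.aeval fun j : Fin (n + 1) => (MvPolynomial.X j.succ.succ : MvPolynomial (Fin (n + 3)) k)) h}) ↔
    Ideal.Quotient.lift _ _ (mk_aeval_proj_eq_zero_of_mem k n h) t ∈ cohomologyAnnihilator (MvPolynomial (Fin (n + 1)) k ⧸ Ideal.span {h}) := by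
  rw [cohomologyAnnihilator_eq_comap_proj k n h2 h hh, Ideal.mem_comap]

/-- Upper half, `ca`-membership form for base elements: `ι s ∈ ca(T_h) ↔ s̄ ∈ ca(C_h)`. [OURS · L1 w44b] -/
theorem mk_inclusion_mem_cohomologyAnnihilator_iff (h2 : (2 : k) ≠ 0) (h : MvPolynomial (Fin (n + 1)) k) (hh : h ≠ 0)
    (s : MvPolynomial (Fin (n + 1)) k) :
    Ideal.Quotient.mk (Ideal.span {MvPolynomial.X 0 * MvPolynomial.X 1 -
        (MvPolynomial.aeval fun j : Fin (n + 1) => (MvPolynomial.X j.succ.succ : MvPolynomial (Fin (n + 3)) k)) h})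
        ((MvPolynomial.aeval fun j : Fin (n + 1) => (MvPolynomial.X j.succ.succ : MvPolynomial (Fin (n + 3)) k)) s) ∈
      cohomologyAnnihilator (MvPolynomial (Fin (n + 3)) k ⧸ Ideal.span {MvPolynomial.X 0 * MvPolynomial.X 1 -
        (MvPolynomial.aeval fun j : Fin (n + 1) => (MvPolynomial.X j.succ.succ : MvPolynomial (Fin (n + 3)) k)) h}) ↔
    Ideal.Quotient.mk (Ideal.span {h}) s ∈ cohomologyAnnihilator (MvPolynomial (Fin (n + 1)) k ⧸ Ideal.span {h}) := by
  rw [mem_cohomologyAnnihilator_iff k n h2 h hh, proj_mk_inclusion]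

end Summit.ResolutionOfSingularities.ResolutionOfSingularities.Theorems.HomologicalConductor.ArenaSandwich

end
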